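import Summits.Ventures.PercRepro.Night2HitCap
import Summits.Ventures.PercRepro.Night2LineFair
import Summits.Ventures.PercRepro.Night2LineLongCell

/-!
# night-2: THE HITTING LINE THEOREM — any line, four line points, hitting off-line sets (gen 39)

Let `(B, z)` be a lossy basis pair of the non-fat cell `(2, 1)`, `ℓ = cl {x, y}` ANY line spanned by two points of
`G ∖ K`, `q = |Q′ ∩ ℓ| ≤ 2`, `D = W ∩ ℓ` (`d = |D|`), `O = W ∖ ℓ` (`k = |O|`), and `A_ℓ` the active faces whose hyperplane
contains `ℓ` (at most three: `card_filter_line_faces_le_three`).  The targets `Q ∪ (Y_D ∪ Y_O)` with `Y_D ⊆ D`, `|Y_D| ≥ 4`,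
`Y_O ⊆ O`, `|Y_O| ≥ 3` and `Y_O` HITTING (`Y_O ⊄ cl (Q.erase w)` for every `w ∈ A_ℓ`) are
* unloaded (`dload_eq_zero_of_line_target_four`),
* hitting in the full sense (a face not containing `ℓ` meets `ℓ` in at most one point, and `Y_D` has four), hence of
  capacity `≥ 11/18` (`vCap_ge_of_hitting`),
* of face sum `≤ lineFaceBound (|Y_D| + q) (|Y_O| + 5 − q) / 3` (`faceSum_le_third_mul_lineCount`),
and the hitting `Y_O` of size `i` number at least `C(k, i) − 3 · C(k − 2, i)` (`card_filter_forall_not_subset_ge`).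
**`basis_pair_fair_of_line_hit`**: the pair is fair as soon as `1 ≤ lineHitIncome q d k :=
Σ_{j=4}^{d} C(d, j) · Σ_{i=3}^{k} (11/18) · (C(k, i) − 3 C(k − 2, i))⁺ · 3 / lineFaceBound (j + q) (i + 5 − q)`.
Paper: proofs/NIGHT-2-g39.md §4.
-/

namespace PercRepro.Shadow

open PercRepro.ThmH PercRepro.PerFlat

variable {α : Type*} [DecidableEq α] {M : Matroid α} [M.Finite] {G : Finset α}

/-- The inner line-hitting income at line level `j`:
`Σ_{i=3}^{k} (11/18) · (C(k, i) − 3 C(k − 2, i))⁺ · 3 / lineFaceBound (j + q) (i + 5 − q)`. -/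
noncomputable def hitInner (q k j : ℕ) : ℚ :=
  ∑ i ∈ Finset.range (k + 1), if 3 ≤ i then
    11 / 18 * max 0 (((k.choose i : ℕ) : ℚ) - 3 * (((k - 2).choose i : ℕ) : ℚ)) * 3 /
      ((lineFaceBound (j + q) (i + 5 - q) : ℕ) : ℚ)
  else 0

/-- The line-hitting income: `Σ_{j=4}^{d} C(d, j) · hitInner q k j`. -/
noncomputable def lineHitIncome (q d k : ℕ) : ℚ :=
  ∑ j ∈ Finset.range (d + 1), if 4 ≤ j then ((d.choose j : ℕ) : ℚ) * hitInner q k j else 0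

/-- Every summand of `hitInner` is nonnegative. -/
theorem hitInner_term_nonneg (q k j i : ℕ) :
    (0 : ℚ) ≤ (if 3 ≤ i then
      11 / 18 * max 0 (((k.choose i : ℕ) : ℚ) - 3 * (((k - 2).choose i : ℕ) : ℚ)) * 3 /
        ((lineFaceBound (j + q) (i + 5 - q) : ℕ) : ℚ) else 0) := by
  split_ifs
  · positivity
  · exact le_rfl

/-- `hitInner` is nonnegative. -/
theorem hitInner_nonneg (q k j : ℕ) : 0 ≤ hitInner q k j :=
  Finset.sum_nonneg (fun i _ => hitInner_term_nonneg q k j i)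

/-- Every summand of `lineHitIncome` is nonnegative. -/
theorem lineHitIncome_term_nonneg (q d k j : ℕ) :
    (0 : ℚ) ≤ (if 4 ≤ j then ((d.choose j : ℕ) : ℚ) * hitInner q k j else 0) := by
  split_ifs
  · exact mul_nonneg (by positivity) (hitInner_nonneg q k j)
  · exact le_rfl

/-- **The active faces whose hyperplane contains a line `cl {x, y}` (`x ≠ y ∈ G ∖ K`) are at most three.** -/
theorem card_filter_line_faces_le_three (hG : G ∈ flatsQ M (5 + 1)) (hd : (gr M \ G).card = 2)
    (hk : kColoops M G = 1) (hs : ∀ e ∈ gr M, ∀ f ∈ gr M, e ≠ f → rkN M {e, f} = 2) {B : Finset α}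
    (hB : B ∈ thinMembers M 5 G) (hnP : ¬ bigP M G B) {z : α} (hz : z ∈ G \ clF M B) {x y : α}
    (hx : x ∈ G \ coloops M G) (hy : y ∈ G \ coloops M G) (hxy : x ≠ y) :
    ((insert z B \ coloops M G).filter (fun w => faceOk M G (insert z B) w ∧
      clF M {x, y} ⊆ clF M ((insert z B).erase w))).card ≤ 3 := by
  have hind : M.Indep ((insert z B \ coloops M G : Finset α) : Set α) :=
    (indep_insert_of_basis_pair hG hd hk hB hnP hz).subset (by exact_mod_cast (Finset.sdiff_subset))
  have hq2 := card_inter_clF_pair_le_two_of_indep hind (a := x) (b := y)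
  obtain ⟨-, hQ'5⟩ := rkN_insert_sdiff_coloops_eq_five hG hd hk hB hnP hz
  rcases Nat.lt_or_ge ((insert z B \ coloops M G) ∩ clF M {x, y}).card 2 with hlt | hge
  · -- at most one basis point on the line: gen 38's bound
    have h2 := card_filter_line_subset_le_two hG hd hk hs hB hnP hz hx hy hxy (by omega)
    refine le_trans (Finset.card_le_card ?_) (le_trans h2 (by norm_num))
    intro w hw
    rw [Finset.mem_filter] at hw ⊢
    exact ⟨hw.1, hw.2.2⟩
  · -- two basis points on the line: the faces containing it avoid their own point
    have hq : ((insert z B \ coloops M G) ∩ clF M {x, y}).card = 2 := by omega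
    have hsub : (insert z B \ coloops M G).filter (fun w => faceOk M G (insert z B) w ∧
        clF M {x, y} ⊆ clF M ((insert z B).erase w)) ⊆ (insert z B \ coloops M G) \ clF M {x, y} := by
      intro w hw
      rw [Finset.mem_filter] at hw
      rw [Finset.mem_sdiff]
      refine ⟨hw.1, fun hwl => ?_⟩
      exact (Finset.mem_sdiff.1 hw.2.1.2).2 (hw.2.2 hwl)
    refine le_trans (Finset.card_le_card hsub) ?_
    have := Finset.card_sdiff_add_card_inter (insert z B \ coloops M G) (clF M {x, y})
    omega

/-- **The per-target bound of the hitting line family**: for `Y_D ⊆ W ∩ cl {x, y}` with `|Y_D| ≥ 4` and a hitting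
`Y_O ⊆ W ∖ cl {x, y}` with `|Y_O| ≥ 3`, `vCap T / faceSum T ≥ (11/18) · 3 / lineFaceBound (|Y_D| + q) (|Y_O| + 5 − q)`. -/
theorem line_hit_term (hG : G ∈ flatsQ M (5 + 1)) (hd : (gr M \ G).card = 2)
    (hk : kColoops M G = 1) (hs : ∀ e ∈ gr M, ∀ f ∈ gr M, e ≠ f → rkN M {e, f} = 2)
    (hl : ∀ e ∈ gr M, M.Indep {e}) (hnf : fatClosures M 5 G 2 = ∅) {B : Finset α}
    (hB : B ∈ thinMembers M 5 G) (hnP : ¬ bigP M G B) {z : α} (hz : z ∈ G \ clF M B)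
    (hl0 : loss M 5 G B z ≠ 0) {x y : α}
    {YD YO : Finset α} (hYD : YD ⊆ (G \ insert z B) ∩ clF M {x, y}) (h4 : 4 ≤ YD.card)
    (hYO : YO ⊆ (G \ insert z B) \ clF M {x, y}) (h3 : 3 ≤ YO.card)
    (hhit : ∀ w ∈ (insert z B \ coloops M G).filter (fun w => faceOk M G (insert z B) w ∧
      clF M {x, y} ⊆ clF M ((insert z B).erase w)), ¬ YO ⊆ clF M ((insert z B).erase w)) :
    11 / 18 * 3 / ((lineFaceBound (YD.card + ((insert z B \ coloops M G) ∩ clF M {x, y}).card)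
      (YO.card + 5 - ((insert z B \ coloops M G) ∩ clF M {x, y}).card) : ℕ) : ℚ) ≤
      vCap M G (insert z B ∪ (YD ∪ YO)) / faceSum M G (insert z B ∪ (YD ∪ YO)) := by
  have hfat : (fatClosures M 5 G 2).card ≤ 1 := by
    rw [hnf, Finset.card_empty]
    exact zero_le_one
  have hQG : insert z B ⊆ G :=
    Finset.insert_subset (Finset.mem_sdiff.1 hz).1 (subset_G_of_mem_thinMembers hB)
  have hind : M.Indep ((insert z B \ coloops M G : Finset α) : Set α) :=
    (indep_insert_of_basis_pair hG hd hk hB hnP hz).subset (by exact_mod_cast (Finset.sdiff_subset))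
  have hq2 := card_inter_clF_pair_le_two_of_indep hind (a := x) (b := y)
  obtain ⟨-, hQ'5⟩ := rkN_insert_sdiff_coloops_eq_five hG hd hk hB hnP hz
  have hℓg : clF M {x, y} ⊆ gr M := fun e he => mem_gr_of_mem_clF he
  have hℓ2 : rkN M (clF M {x, y}) ≤ 2 := by
    refine le_trans (rkN_le_of_subset_clF' (Finset.Subset.refl _)) ?_
    exact le_trans (rkN_le_card _) Finset.card_le_two
  have hYDW : YD ⊆ G \ insert z B := hYD.trans Finset.inter_subset_left
  have hYOW : YO ⊆ G \ insert z B := hYO.trans Finset.sdiff_subset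
  have hYW : YD ∪ YO ⊆ G \ insert z B := Finset.union_subset hYDW hYOW
  have hT : insert z B ∪ (YD ∪ YO) ∈ tgtSets M 5 G B z := by
    rw [tgtSets_eq_image hG (mem_thinMembers.1 hB).1 hz, Finset.mem_image]
    refine ⟨YD ∪ YO, Finset.mem_filter.2 ⟨Finset.mem_powerset.2 hYW, ?_⟩, rfl⟩
    exact Finset.Nonempty.mono Finset.subset_union_left (Finset.card_pos.1 (by omega))
  have hTG : insert z B ∪ (YD ∪ YO) ⊆ G := Finset.union_subset hQG (hYW.trans Finset.sdiff_subset)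
  have hne : (YD ∪ YO).Nonempty :=
    Finset.Nonempty.mono Finset.subset_union_left (Finset.card_pos.1 (by omega))
  -- unloaded
  have hdl : dload M 5 G (bigP M G) (dshGT2 M 5 G) (insert z B ∪ (YD ∪ YO)) = 0 :=
    dload_eq_zero_of_line_target_four hG hd hk hs hl hfat hB hnP hz {x, y} hYD h4 hYO (by omega)
  -- hitting in the full sense
  have hhit' : ∀ w ∈ (insert z B \ coloops M G).filter (fun w => faceOk M G (insert z B) w),
      ¬ YD ∪ YO ⊆ clF M ((insert z B).erase w) := by
    intro w hw hsub
    have hok := (Finset.mem_filter.1 hw).2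
    by_cases hℓ : clF M {x, y} ⊆ clF M ((insert z B).erase w)
    · exact hhit w (Finset.mem_filter.2 ⟨(Finset.mem_filter.1 hw).1, hok, hℓ⟩)
        (Finset.subset_union_right.trans hsub)
    · apply hℓ
      obtain ⟨y₁, hy₁, y₂, hy₂, hne12⟩ := Finset.one_lt_card.1 (show 1 < YD.card by omega)
      exact subset_clF_of_rkN_le_two_of_two_mem hs hℓg hℓ2 (Finset.mem_inter.1 (hYD hy₁)).2
        (Finset.mem_inter.1 (hYD hy₂)).2 hne12 (hsub (Finset.mem_union_left _ hy₁))
        (hsub (Finset.mem_union_left _ hy₂))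
  have hv := vCap_ge_of_hitting hG hd hk hB hnP hz hYW hne hdl hhit'
  have hpos := faceSum_pos_of_mem_tgtSets hG hd hk hB hnP hz hl0 hT
  have hfs := faceSum_le_third_mul_lineCount hG hd hk hnf hTG x y
  -- the line counts of the target
  have hT'K := union_sdiff_coloops_eq_of_subset hG hd hB (z := z) hYW
  have hcard_in : (((insert z B ∪ (YD ∪ YO)) \ coloops M G) ∩ clF M {x, y}).card ≤
      YD.card + ((insert z B \ coloops M G) ∩ clF M {x, y}).card := by
    rw [hT'K, Finset.union_inter_distrib_right, Finset.union_inter_distrib_right]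
    have hYOl : YO ∩ clF M {x, y} = ∅ := by
      rw [Finset.eq_empty_iff_forall_notMem]
      intro e he
      exact (Finset.mem_sdiff.1 (hYO (Finset.mem_inter.1 he).1)).2 (Finset.mem_inter.1 he).2
    rw [hYOl, Finset.union_empty]
    refine le_trans (Finset.card_union_le _ _) ?_
    have := Finset.card_le_card (Finset.inter_subset_left : YD ∩ clF M {x, y} ⊆ YD)
    omega
  have hcard_off : (((insert z B ∪ (YD ∪ YO)) \ coloops M G) \ clF M {x, y}).card ≤
      YO.card + 5 - ((insert z B \ coloops M G) ∩ clF M {x, y}).card := by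
    rw [hT'K, Finset.union_sdiff_distrib, Finset.union_sdiff_distrib]
    have hYDl : YD \ clF M {x, y} = ∅ := by
      rw [Finset.eq_empty_iff_forall_notMem]
      intro e he
      exact (Finset.mem_sdiff.1 he).2 (Finset.mem_inter.1 (hYD (Finset.mem_sdiff.1 he).1)).2
    rw [hYDl, Finset.empty_union]
    have hQ'off := Finset.card_sdiff_add_card_inter (insert z B \ coloops M G) (clF M {x, y})
    refine le_trans (Finset.card_union_le _ _) ?_
    have := Finset.card_le_card (Finset.sdiff_subset : YO \ clF M {x, y} ⊆ YO)
    omega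
  have hfs' : faceSum M G (insert z B ∪ (YD ∪ YO)) ≤ 1 / 3 * ((lineFaceBound (YD.card +
      ((insert z B \ coloops M G) ∩ clF M {x, y}).card)
      (YO.card + 5 - ((insert z B \ coloops M G) ∩ clF M {x, y}).card) : ℕ) : ℚ) := by
    refine le_trans hfs ?_
    apply mul_le_mul_of_nonneg_left _ (by norm_num)
    exact_mod_cast lineFaceBound_mono hcard_in hcard_off
  have hLpos : (0 : ℚ) < ((lineFaceBound (YD.card + ((insert z B \ coloops M G) ∩ clF M {x, y}).card)
      (YO.card + 5 - ((insert z B \ coloops M G) ∩ clF M {x, y}).card) : ℕ) : ℚ) := by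
    exact_mod_cast lineFaceBound_pos (by omega)
  rw [div_le_div_iff₀ hLpos hpos]
  nlinarith

/-- **The abstract inner count**: over the hitting subsets of `O` with at least three points (at most three sets `C w`,
each missing `≥ 2` points of `O`), `Σ (11/18) · 3 / lineFaceBound (j + q) (|Y_O| + 5 − q) ≥ hitInner q |O| j`. -/
theorem hitInner_le_sum_filter {β : Type*} (O : Finset α) (A : Finset β) (C : β → Finset α)
    (hC : ∀ w ∈ A, (C w ∩ O).card + 2 ≤ O.card) (hA : A.card ≤ 3) (q j : ℕ) :
    hitInner q O.card j ≤ ∑ YO ∈ O.powerset.filter (fun YO => 3 ≤ YO.card ∧ ∀ w ∈ A, ¬ YO ⊆ C w),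
      11 / 18 * 3 / ((lineFaceBound (j + q) (YO.card + 5 - q) : ℕ) : ℚ) := by
  set Os : Finset (Finset α) := O.powerset.filter (fun YO => 3 ≤ YO.card ∧ ∀ w ∈ A, ¬ YO ⊆ C w) with hOs
  have hmaps : ∀ YO ∈ Os, YO.card ∈ Finset.range (O.card + 1) := fun YO hYO =>
    Finset.mem_range.2 (Nat.lt_succ_of_le (Finset.card_le_card
      (Finset.mem_powerset.1 (Finset.mem_filter.1 hYO).1)))
  have hfiber := Finset.sum_fiberwise_of_maps_to hmaps
    (fun YO => 11 / 18 * 3 / ((lineFaceBound (j + q) (YO.card + 5 - q) : ℕ) : ℚ))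
  rw [← hfiber]
  unfold hitInner
  apply Finset.sum_le_sum
  intro i _
  have hfib : ∑ YO ∈ Os.filter (fun YO => YO.card = i),
      11 / 18 * 3 / ((lineFaceBound (j + q) (YO.card + 5 - q) : ℕ) : ℚ) =
      ((Os.filter (fun YO => YO.card = i)).card : ℚ) *
        (11 / 18 * 3 / ((lineFaceBound (j + q) (i + 5 - q) : ℕ) : ℚ)) := by
    rw [Finset.sum_congr rfl (fun YO hYO => by rw [(Finset.mem_filter.1 hYO).2])]
    rw [Finset.sum_const, nsmul_eq_mul]
  rw [hfib]
  split_ifs with h3i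
  · have hcount := card_filter_forall_not_subset_ge O A C hC i
    have hsub : (O.powersetCard i).filter (fun YO => ∀ w ∈ A, ¬ YO ⊆ C w) ⊆
        Os.filter (fun YO => YO.card = i) := by
      intro YO hYO
      rw [Finset.mem_filter, Finset.mem_powersetCard] at hYO
      obtain ⟨⟨hYOO, hYOi⟩, hhit⟩ := hYO
      rw [Finset.mem_filter, hOs, Finset.mem_filter, Finset.mem_powerset]
      exact ⟨⟨hYOO, by omega, hhit⟩, hYOi⟩
    have hcard : (((O.powersetCard i).filter (fun YO => ∀ w ∈ A, ¬ YO ⊆ C w)).card : ℚ) ≤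
        ((Os.filter (fun YO => YO.card = i)).card : ℚ) := by
      exact_mod_cast Finset.card_le_card hsub
    have hA' : (A.card : ℚ) ≤ 3 := by exact_mod_cast hA
    have h0 : (0 : ℚ) ≤ (((O.card - 2).choose i : ℕ) : ℚ) := by positivity
    have hmax : max 0 (((O.card.choose i : ℕ) : ℚ) - 3 * (((O.card - 2).choose i : ℕ) : ℚ)) ≤
        ((Os.filter (fun YO => YO.card = i)).card : ℚ) := by
      apply max_le (by positivity)
      nlinarith
    have hF : (0 : ℚ) ≤ 11 / 18 * 3 / ((lineFaceBound (j + q) (i + 5 - q) : ℕ) : ℚ) := by positivity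
    calc 11 / 18 * max 0 (((O.card.choose i : ℕ) : ℚ) - 3 * (((O.card - 2).choose i : ℕ) : ℚ)) * 3 /
          ((lineFaceBound (j + q) (i + 5 - q) : ℕ) : ℚ)
        = max 0 (((O.card.choose i : ℕ) : ℚ) - 3 * (((O.card - 2).choose i : ℕ) : ℚ)) *
          (11 / 18 * 3 / ((lineFaceBound (j + q) (i + 5 - q) : ℕ) : ℚ)) := by ring
      _ ≤ ((Os.filter (fun YO => YO.card = i)).card : ℚ) *
          (11 / 18 * 3 / ((lineFaceBound (j + q) (i + 5 - q) : ℕ) : ℚ)) :=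
          mul_le_mul_of_nonneg_right hmax hF
  · positivity

/-- **The hitting line targets are targets and their income is at least `lineHitIncome q d k`** (`ℓ = cl {x, y}`,
`x ≠ y ∈ G ∖ K`, `q = |Q′ ∩ ℓ|`, `d = |W ∩ ℓ|`, `k = |W ∖ ℓ|`). -/
theorem line_hit_targets_subset_and_income (hG : G ∈ flatsQ M (5 + 1)) (hd : (gr M \ G).card = 2)
    (hk : kColoops M G = 1) (hs : ∀ e ∈ gr M, ∀ f ∈ gr M, e ≠ f → rkN M {e, f} = 2)
    (hl : ∀ e ∈ gr M, M.Indep {e}) (hnf : fatClosures M 5 G 2 = ∅) {B : Finset α}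
    (hB : B ∈ thinMembers M 5 G) (hnP : ¬ bigP M G B) {z : α} (hz : z ∈ G \ clF M B)
    (hl0 : loss M 5 G B z ≠ 0) {x y : α} (hx : x ∈ G \ coloops M G) (hy : y ∈ G \ coloops M G) (hxy : x ≠ y) :
    (((((G \ insert z B) ∩ clF M {x, y}).powerset.filter (fun YD => 4 ≤ YD.card)) ×ˢ
      (((G \ insert z B) \ clF M {x, y}).powerset.filter (fun YO => 3 ≤ YO.card ∧
        ∀ w ∈ (insert z B \ coloops M G).filter (fun w => faceOk M G (insert z B) w ∧
          clF M {x, y} ⊆ clF M ((insert z B).erase w)), ¬ YO ⊆ clF M ((insert z B).erase w)))).image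
        (fun p => insert z B ∪ (p.1 ∪ p.2))) ⊆ tgtSets M 5 G B z ∧
      lineHitIncome ((insert z B \ coloops M G) ∩ clF M {x, y}).card ((G \ insert z B) ∩ clF M {x, y}).card
        ((G \ insert z B) \ clF M {x, y}).card ≤
      ∑ T ∈ ((((G \ insert z B) ∩ clF M {x, y}).powerset.filter (fun YD => 4 ≤ YD.card)) ×ˢ
        (((G \ insert z B) \ clF M {x, y}).powerset.filter (fun YO => 3 ≤ YO.card ∧
          ∀ w ∈ (insert z B \ coloops M G).filter (fun w => faceOk M G (insert z B) w ∧
            clF M {x, y} ⊆ clF M ((insert z B).erase w)), ¬ YO ⊆ clF M ((insert z B).erase w)))).image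
          (fun p => insert z B ∪ (p.1 ∪ p.2)), vCap M G T / faceSum M G T := by
  have hQG : insert z B ⊆ G :=
    Finset.insert_subset (Finset.mem_sdiff.1 hz).1 (subset_G_of_mem_thinMembers hB)
  have hA3 := card_filter_line_faces_le_three hG hd hk hs hB hnP hz hx hy hxy
  set D : Finset α := (G \ insert z B) ∩ clF M {x, y} with hDdef
  set O : Finset α := (G \ insert z B) \ clF M {x, y} with hOdef
  set Aℓ : Finset α := (insert z B \ coloops M G).filter (fun w => faceOk M G (insert z B) w ∧
    clF M {x, y} ⊆ clF M ((insert z B).erase w)) with hAdef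
  set Ds : Finset (Finset α) := D.powerset.filter (fun YD => 4 ≤ YD.card) with hDs
  set Os : Finset (Finset α) := O.powerset.filter (fun YO => 3 ≤ YO.card ∧
    ∀ w ∈ Aℓ, ¬ YO ⊆ clF M ((insert z B).erase w)) with hOs
  set 𝒯 : Finset (Finset α) := (Ds ×ˢ Os).image (fun p => insert z B ∪ (p.1 ∪ p.2)) with h𝒯
  have hmemD : ∀ YD ∈ Ds, YD ⊆ D ∧ 4 ≤ YD.card := fun YD hYD => by
    have := Finset.mem_filter.1 hYD
    exact ⟨Finset.mem_powerset.1 this.1, this.2⟩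
  have hmemO : ∀ YO ∈ Os, YO ⊆ O ∧ 3 ≤ YO.card ∧ ∀ w ∈ Aℓ, ¬ YO ⊆ clF M ((insert z B).erase w) :=
    fun YO hYO => by
      have := Finset.mem_filter.1 hYO
      exact ⟨Finset.mem_powerset.1 this.1, this.2.1, this.2.2⟩
  have hDW : D ⊆ G \ insert z B := Finset.inter_subset_left
  have hOW : O ⊆ G \ insert z B := Finset.sdiff_subset
  -- the targets
  have h𝒯sub : 𝒯 ⊆ tgtSets M 5 G B z := by
    intro T hT
    rw [h𝒯, Finset.mem_image] at hT
    obtain ⟨p, hp, rfl⟩ := hT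
    rw [Finset.mem_product] at hp
    obtain ⟨hYD, hYDc⟩ := hmemD p.1 hp.1
    obtain ⟨hYO, hYOc, -⟩ := hmemO p.2 hp.2
    rw [tgtSets_eq_image hG (mem_thinMembers.1 hB).1 hz, Finset.mem_image]
    refine ⟨p.1 ∪ p.2, Finset.mem_filter.2 ⟨Finset.mem_powerset.2
      (Finset.union_subset (hYD.trans hDW) (hYO.trans hOW)), ?_⟩, rfl⟩
    exact Finset.Nonempty.mono Finset.subset_union_left (Finset.card_pos.1 (by omega))
  -- injectivity: `Y_D = T ∩ D`, `Y_O = T ∩ O`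
  have hinj : Set.InjOn (fun p : Finset α × Finset α => insert z B ∪ (p.1 ∪ p.2))
      ((Ds ×ˢ Os : Finset _) : Set _) := by
    intro p₁ hp₁ p₂ hp₂ heq
    rw [Finset.mem_coe, Finset.mem_product] at hp₁ hp₂
    have keyD : ∀ p ∈ Ds ×ˢ Os, (insert z B ∪ (p.1 ∪ p.2)) ∩ D = p.1 := by
      intro p hp
      rw [Finset.mem_product] at hp
      ext e
      rw [Finset.mem_inter, Finset.mem_union, Finset.mem_union]
      constructor
      · rintro ⟨he | he | he, heD⟩
        · exact absurd he (Finset.mem_sdiff.1 (hDW heD)).2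
        · exact he
        · exact absurd (Finset.mem_inter.1 heD).2 (Finset.mem_sdiff.1 ((hmemO p.2 hp.2).1 he)).2
      · intro he
        exact ⟨Or.inr (Or.inl he), (hmemD p.1 hp.1).1 he⟩
    have keyO : ∀ p ∈ Ds ×ˢ Os, (insert z B ∪ (p.1 ∪ p.2)) ∩ O = p.2 := by
      intro p hp
      rw [Finset.mem_product] at hp
      ext e
      rw [Finset.mem_inter, Finset.mem_union, Finset.mem_union]
      constructor
      · rintro ⟨he | he | he, heO⟩
        · exact absurd he (Finset.mem_sdiff.1 (hOW heO)).2
        · exact absurd (Finset.mem_inter.1 ((hmemD p.1 hp.1).1 he)).2 (Finset.mem_sdiff.1 heO).2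
        · exact he
      · intro he
        exact ⟨Or.inr (Or.inr he), (hmemO p.2 hp.2).1 he⟩
    have hD₁ := keyD p₁ (Finset.mem_product.2 hp₁)
    have hD₂ := keyD p₂ (Finset.mem_product.2 hp₂)
    have hO₁ := keyO p₁ (Finset.mem_product.2 hp₁)
    have hO₂ := keyO p₂ (Finset.mem_product.2 hp₂)
    simp only at heq
    apply Prod.ext
    · rw [← hD₁, ← hD₂, heq]
    · rw [← hO₁, ← hO₂, heq]
  -- the per-target bound, summed over the product
  have hterm : ∀ p ∈ Ds ×ˢ Os, 11 / 18 * 3 / ((lineFaceBound (p.1.card +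
      ((insert z B \ coloops M G) ∩ clF M {x, y}).card)
      (p.2.card + 5 - ((insert z B \ coloops M G) ∩ clF M {x, y}).card) : ℕ) : ℚ) ≤
      vCap M G (insert z B ∪ (p.1 ∪ p.2)) / faceSum M G (insert z B ∪ (p.1 ∪ p.2)) := by
    intro p hp
    rw [Finset.mem_product] at hp
    obtain ⟨hYD, hYDc⟩ := hmemD p.1 hp.1
    obtain ⟨hYO, hYOc, hYOhit⟩ := hmemO p.2 hp.2
    exact line_hit_term hG hd hk hs hl hnf hB hnP hz hl0 hYD hYDc hYO hYOc hYOhit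
  have hsum𝒯 : ∑ p ∈ Ds ×ˢ Os, 11 / 18 * 3 / ((lineFaceBound (p.1.card +
      ((insert z B \ coloops M G) ∩ clF M {x, y}).card)
      (p.2.card + 5 - ((insert z B \ coloops M G) ∩ clF M {x, y}).card) : ℕ) : ℚ) ≤
      ∑ T ∈ 𝒯, vCap M G T / faceSum M G T := by
    rw [h𝒯, Finset.sum_image hinj]
    exact Finset.sum_le_sum hterm
  rw [Finset.sum_product] at hsum𝒯
  refine ⟨h𝒯sub, le_trans ?_ hsum𝒯⟩
  -- the inner sums: the hitting count at each off-line level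
  have hC : ∀ w ∈ Aℓ, (clF M ((insert z B).erase w) ∩ O).card + 2 ≤ O.card := by
    intro w hw
    rw [hAdef, Finset.mem_filter] at hw
    have hholes := two_le_card_holes hG hnf hQG hw.2.1
    have hsub : (G \ insert z B) \ clF M ((insert z B).erase w) ⊆ O \ clF M ((insert z B).erase w) := by
      intro e he
      rw [Finset.mem_sdiff] at he ⊢
      exact ⟨Finset.mem_sdiff.2 ⟨he.1, fun hel => he.2 (hw.2.2 hel)⟩, he.2⟩
    have h1 := Finset.card_le_card hsub
    have h2 := Finset.card_sdiff_add_card_inter O (clF M ((insert z B).erase w))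
    rw [Finset.inter_comm]
    omega
  have hinner : ∀ YD ∈ Ds, hitInner ((insert z B \ coloops M G) ∩ clF M {x, y}).card O.card YD.card ≤
      ∑ YO ∈ Os, 11 / 18 * 3 / ((lineFaceBound (YD.card + ((insert z B \ coloops M G) ∩ clF M {x, y}).card)
        (YO.card + 5 - ((insert z B \ coloops M G) ∩ clF M {x, y}).card) : ℕ) : ℚ) := fun YD _ =>
    hitInner_le_sum_filter O Aℓ (fun w => clF M ((insert z B).erase w)) hC hA3 _ YD.card
  refine le_trans ?_ (Finset.sum_le_sum hinner)
  -- the outer sum: regroup by `|Y_D|`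
  unfold lineHitIncome
  rw [hDs, Finset.sum_filter]
  rw [Finset.sum_powerset_apply_card (fun j => if 4 ≤ j then
    hitInner ((insert z B \ coloops M G) ∩ clF M {x, y}).card O.card j else 0)]
  apply le_of_eq
  apply Finset.sum_congr rfl
  intro j _
  rw [nsmul_eq_mul]
  split_ifs
  · rfl
  · rw [mul_zero]

/-- **THE HITTING LINE THEOREM**: a lossy basis pair of the non-fat cell `(2, 1)` is fair as soon as
`1 ≤ lineHitIncome q d k` for some line `cl {x, y}` (`x ≠ y ∈ G ∖ K`), `q = |Q′ ∩ cl {x, y}|`, `d = |W ∩ cl {x, y}|`,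
`k = |W ∖ cl {x, y}|`. -/
theorem basis_pair_fair_of_line_hit (hG : G ∈ flatsQ M (5 + 1)) (hd : (gr M \ G).card = 2)
    (hk : kColoops M G = 1) (hs : ∀ e ∈ gr M, ∀ f ∈ gr M, e ≠ f → rkN M {e, f} = 2)
    (hl : ∀ e ∈ gr M, M.Indep {e}) (hnf : fatClosures M 5 G 2 = ∅) {B : Finset α}
    (hB : B ∈ thinMembers M 5 G) (hnP : ¬ bigP M G B) {z : α} (hz : z ∈ G \ clF M B)
    (hl0 : loss M 5 G B z ≠ 0) {x y : α} (hx : x ∈ G \ coloops M G) (hy : y ∈ G \ coloops M G) (hxy : x ≠ y)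
    (hsum : 1 ≤ lineHitIncome ((insert z B \ coloops M G) ∩ clF M {x, y}).card
      ((G \ insert z B) ∩ clF M {x, y}).card ((G \ insert z B) \ clF M {x, y}).card) :
    loss M 5 G B z ≤ rhoL M 5 G B z * lossIncomeH M 5 G (bigP M G) (dshGT2 M 5 G) B z := by
  have hfat : (fatClosures M 5 G 2).card ≤ 1 := by
    rw [hnf, Finset.card_empty]
    exact zero_le_one
  obtain ⟨hsub, hinc⟩ := line_hit_targets_subset_and_income hG hd hk hs hl hnf hB hnP hz hl0 hx hy hxy
  exact basis_pair_fair_of_vCap_face_sum_subfamily hG hd hk hs hl hfat hB hnP hz hl0 hsub (hsum.trans hinc)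

end PercRepro.Shadow
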